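import Mathlib
import Summits.ResolutionOfSingularities.ResolutionOfSingularities.Theorems.RisoStrataRtdLocalArcEquiv

/-!
# Stub `stub_sheafCondition` of crux `RisoGlobalisation` (stmt-ResolutionOfSingularities-18547)

Line `SketchIdeator1`.  Sheaf condition for the centre ideals of two charts.  Let
`B, B' ⊆ K` be finitely generated `k`-subalgebras of a field with a common principal
localisation `B'' := Algebra.adjoin k (B ∪ {s⁻¹}) = Algebra.adjoin k (B' ∪ {(s⁻¹)⁻¹})`
(`s ∈ B`, `s⁻¹ ∈ B'`, `s ≠ 0`), and let `P` be a predicate on (subalgebra, ideal) pairs which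
is Zariski-local in the sense of the crux's hypothesis H₁ (invariant under contraction along
`B ⊆ B[s⁻¹]` at maximal ideals).  Call a maximal ideal *bad* if its local ring is not regular
and `P` holds, and let `I_B` (`I_{B'}`) be the intersection of the bad maximal ideals of `B`
(`B'`).  Then every `c ∈ I_B` satisfies `c · (s⁻¹)ⁿ ∈ I_{B'}` for some `n`.

Proof (direct, no Zariski topology).  `B''` is the localisation of `B` away from `s` and of
`B'` away from `s⁻¹` (`arcEquiv_isLocalization` from the tree, transported along the equality
of subalgebras).  Write `c = b' / (s⁻¹)ʲ` with `b' ∈ B'` and put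
`a := b' · s⁻¹ = c · (s⁻¹)ʲ⁺¹`.  For a bad maximal ideal `m'` of `B'`: if `s⁻¹ ∈ m'` then
`a ∈ m'` trivially; otherwise `m'` extends to a maximal ideal `M'` of `B''` contracting to `m'`
(finitely generated algebras are Jacobson, `IsLocalization.isMaximal_of_isMaximal_disjoint`),
whose contraction `m` to `B` is maximal (`IsLocalization.isMaximal_iff_isMaximal_disjoint`),
has local ring `B_m ≅ B''_{M'} ≅ B'_{m'}` (localisation at a prime of a localisation), hence
not regular, and satisfies `P` by H₁ applied twice; so `m` is bad, `c ∈ m ⊆ M'`,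
`b' = c · (s⁻¹)ʲ ∈ M' ∩ B' = m'` and `a ∈ m'`.  The ring-theoretic core is
`sheafCondition_of_isLocalization`, stated for an arbitrary common localisation `S` of two
Jacobson rings `R`, `R'`.
-/

-- single-problem summit: the doubled namespace component `ResolutionOfSingularities` is forced
set_option linter.dupNamespace false

namespace Summit.ResolutionOfSingularities.ResolutionOfSingularities.Theorems

section SheafConditionHelpers

/-- Regularity of the local ring at a prime `M` of a localisation `S` of `R` is regularity of
the local ring of `R` at the contraction `m = M ∩ R`: both are the same ring
(`IsLocalization.isLocalization_isLocalization_atPrime_isLocalization`). -/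
theorem sheafCondition_isRegularLocalRing_iff {R S : Type*} [CommRing R] [CommRing S]
    [Algebra R S] (N : Submonoid R) [IsLocalization N S] (M : Ideal S) [M.IsPrime]
    (m : Ideal R) [m.IsPrime] (hm : M.comap (algebraMap R S) = m) :
    IsRegularLocalRing (Localization.AtPrime M) ↔ IsRegularLocalRing (Localization.AtPrime m) := by
  have : IsLocalization.AtPrime (Localization.AtPrime M) m := by
    convert IsLocalization.isLocalization_isLocalization_atPrime_isLocalization N
      (Localization.AtPrime M) M
    exact hm.symm
  let e := (IsLocalization.algEquiv m.primeCompl (Localization.AtPrime m)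
    (Localization.AtPrime M)).toRingEquiv
  exact ⟨fun _ => IsRegularLocalRing.of_ringEquiv e.symm,
    fun _ => IsRegularLocalRing.of_ringEquiv e⟩

/-- **Ring-theoretic core of the sheaf condition.**  `S` is simultaneously the localisation of
the Jacobson ring `R` away from `x` and of the Jacobson ring `R'` away from `x'`; `Q`, `Q'` are
predicates on ideals of `R`, `R'` which agree on the contractions of every maximal ideal of `S`.
If `c ∈ R` lies in every maximal ideal `m` of `R` with `R_m` not regular and `Q m`, then some
`c · x'ⁿ` comes from an element `a ∈ R'` lying in every maximal ideal `m'` of `R'` with `R'_{m'}`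
not regular and `Q' m'`. -/
theorem sheafCondition_of_isLocalization {R R' S : Type*} [CommRing R] [CommRing R']
    [CommRing S] [Algebra R S] [Algebra R' S] [IsJacobsonRing R] [IsJacobsonRing R']
    (x : R) (x' : R') [IsLocalization.Away x S] [IsLocalization.Away x' S]
    (Q : Ideal R → Prop) (Q' : Ideal R' → Prop)
    (hQ : ∀ M : Ideal S, M.IsMaximal →
      (Q (M.comap (algebraMap R S)) ↔ Q' (M.comap (algebraMap R' S))))
    (c : R)
    (hc : c ∈ ⨅ m ∈ {m : Ideal R | ∃ hm : m.IsMaximal,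
      ¬ IsRegularLocalRing (Localization (@Ideal.primeCompl R _ m hm.isPrime)) ∧ Q m}, m) :
    ∃ (n : ℕ) (a : R'),
      a ∈ (⨅ m ∈ {m : Ideal R' | ∃ hm : m.IsMaximal,
        ¬ IsRegularLocalRing (Localization (@Ideal.primeCompl R' _ m hm.isPrime)) ∧ Q' m}, m) ∧
      algebraMap R' S a = algebraMap R S c * algebraMap R' S x' ^ n := by
  -- write `c = b' / x' ^ j` over `R'`
  obtain ⟨⟨b', y⟩, hy⟩ := IsLocalization.surj (Submonoid.powers x') (algebraMap R S c)
  obtain ⟨j, hj⟩ := (Submonoid.mem_powers_iff _ _).mp y.2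
  simp only [Ideal.mem_iInf, Set.mem_setOf_eq] at hc
  refine ⟨j + 1, b' * x', ?_, ?_⟩
  · simp only [Ideal.mem_iInf, Set.mem_setOf_eq]
    rintro m' ⟨hm', hreg', hQm'⟩
    by_cases hxm' : x' ∈ m'
    · exact m'.mul_mem_left b' hxm'
    · -- the extension `M'` of `m'` to `S` is maximal and contracts to `m'`
      have hM' : (m'.map (algebraMap R' S)).IsMaximal :=
        IsLocalization.isMaximal_of_isMaximal_disjoint x' m' hm' hxm'
      haveI := hM'.isPrime
      haveI := hm'.isPrime
      have hcm' : (m'.map (algebraMap R' S)).comap (algebraMap R' S) = m' :=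
        IsLocalization.under_map_of_isPrime_disjoint (Submonoid.powers x') S hm'.isPrime
          ((Ideal.disjoint_powers_iff_notMem_of_isPrime x').mpr hxm')
      -- its contraction `m` to `R` is a bad maximal ideal, so it contains `c`
      have hm : ((m'.map (algebraMap R' S)).comap (algebraMap R S)).IsMaximal :=
        ((IsLocalization.isMaximal_iff_isMaximal_disjoint S x _).mp hM').1
      have hcm : c ∈ (m'.map (algebraMap R' S)).comap (algebraMap R S) := by
        refine hc _ ⟨hm, fun hreg => hreg' ?_, (hQ _ hM').mpr (by rw [hcm']; exact hQm')⟩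
        have h1 := (sheafCondition_isRegularLocalRing_iff (Submonoid.powers x)
          (m'.map (algebraMap R' S)) _ rfl).mpr hreg
        exact (sheafCondition_isRegularLocalRing_iff (Submonoid.powers x')
          (m'.map (algebraMap R' S)) m' hcm').mp h1
      rw [Ideal.mem_comap] at hcm
      have hb' : algebraMap R' S b' ∈ m'.map (algebraMap R' S) := by
        rw [← hy]
        exact Ideal.mul_mem_right _ _ hcm
      rw [← Ideal.mem_comap, hcm'] at hb'
      exact m'.mul_mem_right x' hb'
  · rw [map_mul, ← hy, ← hj, map_pow, pow_succ, mul_assoc]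

variable {k K : Type} [Field k] [Field K] [Algebra k K]

/-- A finitely generated subalgebra of a field extension `K / k` is a Jacobson ring. -/
theorem sheafCondition_isJacobsonRing {B : Subalgebra k K} (hB : B.FG) : IsJacobsonRing ↥B := by
  haveI : Algebra.FiniteType k ↥B := B.fg_iff_finiteType.mp hB
  exact isJacobsonRing_of_finiteType (A := k)

/-- Transport of the locality of a predicate `P` along an equality of subalgebras. -/
theorem sheafCondition_transport_iff (P : ∀ B : Subalgebra k K, Ideal ↥B → Prop)
    {B' A A' : Subalgebra k K} (h : A = A') (hle : B' ≤ A) (hle' : B' ≤ A')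
    (H : ∀ m' : Ideal ↥A', m'.IsMaximal →
      (P A' m' ↔ P B' (m'.comap (Subalgebra.inclusion hle')))) :
    ∀ m : Ideal ↥A, m.IsMaximal → (P A m ↔ P B' (m.comap (Subalgebra.inclusion hle))) := by
  subst h
  exact H

/-- Transport of "`A` is the localisation of `B'` away from `x`" along an equality of
subalgebras. -/
theorem sheafCondition_transport_isLocalization {B' A A' : Subalgebra k K} (h : A = A')
    (hle : B' ≤ A) (hle' : B' ≤ A') (x : ↥B')
    (H : letI := (Subalgebra.inclusion hle').toRingHom.toAlgebra
      IsLocalization.Away x ↥A') :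
    letI := (Subalgebra.inclusion hle).toRingHom.toAlgebra
    IsLocalization.Away x ↥A := by
  subst h
  exact H

end SheafConditionHelpers

section Algebra

variable {k K : Type} [Field k] [Field K] [Algebra k K]

/-- **Sheaf condition for the centre ideals of two charts** (stub `stub_sheafCondition` of crux
`RisoGlobalisation`, line `SketchIdeator1`; the place where H₁ = `hP` is consumed).  `B, B' ⊆ K`
finitely generated `k`-subalgebras with a common principal localisation
`B[s⁻¹] = B'[(s⁻¹)⁻¹]` (`s ∈ B`, `s⁻¹ ∈ B'`); the "bad" maximal ideals are the singular ones
satisfying the Zariski-local predicate `P`; then every element of the intersection of the bad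
maximal ideals of `B` becomes, after multiplication by a power of `s⁻¹`, an element of the
intersection of the bad maximal ideals of `B'`. -/
theorem stub_sheafCondition
    (P : ∀ B : Subalgebra k K, Ideal ↥B → Prop)
    (hP : ∀ (B : Subalgebra k K) (s : K) (_ : s ∈ B), s ≠ 0 → B.FG →
      ∀ m' : Ideal ↥(Algebra.adjoin k ((B : Set K) ∪ {s⁻¹})), m'.IsMaximal →
        (P (Algebra.adjoin k ((B : Set K) ∪ {s⁻¹})) m' ↔
          P B (m'.comap (Subalgebra.inclusion
            (show B ≤ Algebra.adjoin k ((B : Set K) ∪ {s⁻¹}) from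
              fun _ hb => Algebra.subset_adjoin (Set.mem_union_left _ hb))))))
    (B B' : Subalgebra k K) (hB : B.FG) (hB' : B'.FG) (s : K) (hsB : s ∈ B) (hsB' : s⁻¹ ∈ B')
    (hs : s ≠ 0)
    (hBB' : Algebra.adjoin k ((B : Set K) ∪ {s⁻¹}) = Algebra.adjoin k ((B' : Set K) ∪ {s⁻¹⁻¹}))
    (c : ↥B)
    (hc : c ∈ ⨅ m ∈ {m : Ideal ↥B | ∃ hm : m.IsMaximal,
      ¬ IsRegularLocalRing (Localization (@Ideal.primeCompl ↥B _ m hm.isPrime)) ∧ P B m}, m) :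
    ∃ (n : ℕ) (a : ↥B'),
      a ∈ (⨅ m ∈ {m : Ideal ↥B' | ∃ hm : m.IsMaximal,
        ¬ IsRegularLocalRing (Localization (@Ideal.primeCompl ↥B' _ m hm.isPrime)) ∧ P B' m}, m) ∧
      (a : K) = (c : K) * s⁻¹ ^ n := by
  have hle : B ≤ Algebra.adjoin k ((B : Set K) ∪ {s⁻¹}) :=
    fun _ hb => Algebra.subset_adjoin (Set.mem_union_left _ hb)
  have hle'₀ : B' ≤ Algebra.adjoin k ((B' : Set K) ∪ {s⁻¹⁻¹}) :=
    fun _ hb => Algebra.subset_adjoin (Set.mem_union_left _ hb)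
  have hle' : B' ≤ Algebra.adjoin k ((B : Set K) ∪ {s⁻¹}) := hle'₀.trans hBB'.ge
  letI algB : Algebra ↥B ↥(Algebra.adjoin k ((B : Set K) ∪ {s⁻¹})) :=
    (Subalgebra.inclusion hle).toRingHom.toAlgebra
  letI algB' : Algebra ↥B' ↥(Algebra.adjoin k ((B : Set K) ∪ {s⁻¹})) :=
    (Subalgebra.inclusion hle').toRingHom.toAlgebra
  haveI : IsLocalization.Away (⟨s, hsB⟩ : ↥B) ↥(Algebra.adjoin k ((B : Set K) ∪ {s⁻¹})) :=
    arcEquiv_isLocalization hsB hs hle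
  haveI : IsLocalization.Away (⟨s⁻¹, hsB'⟩ : ↥B') ↥(Algebra.adjoin k ((B : Set K) ∪ {s⁻¹})) :=
    sheafCondition_transport_isLocalization hBB' hle' hle'₀ _
      (arcEquiv_isLocalization hsB' (inv_ne_zero hs) hle'₀)
  haveI := sheafCondition_isJacobsonRing hB
  haveI := sheafCondition_isJacobsonRing hB'
  have hPB' := sheafCondition_transport_iff P hBB' hle' hle'₀
    (hP B' s⁻¹ hsB' (inv_ne_zero hs) hB')
  obtain ⟨n, a, ha, heq⟩ := sheafCondition_of_isLocalization (⟨s, hsB⟩ : ↥B)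
    (⟨s⁻¹, hsB'⟩ : ↥B') (P B) (P B')
    (fun M hM => (hP B s hsB hs hB M hM).symm.trans (hPB' M hM)) c hc
  refine ⟨n, a, ha, ?_⟩
  have heqK := congrArg Subtype.val heq
  rw [Subalgebra.coe_mul, Subalgebra.coe_pow] at heqK
  exact heqK

end Algebra

end Summit.ResolutionOfSingularities.ResolutionOfSingularities.Theorems
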